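import Literature.Topology.FourManifolds.SimplifiedBrokenLefschetzSidesGenus
import Literature.Topology.FourManifolds.SimplifiedBrokenLefschetzRoundSlicesIndex
import Literature.Topology.FourManifolds.SimplifiedBrokenLefschetzHeight
import Literature.Topology.FourManifolds.SphereHeightFoldCurves
import Summits.SmoothPoincare4.SmoothPoincare4.Theorems.SblfDescentRungOneStubSixCritAux1
import Summits.SmoothPoincare4.SmoothPoincare4.Theorems.SblfDescentRungOneStubSixCritAux2
import HarnessLib

/-!
# The six-point Morse function — stub `stub_sixCrit` of line `Sketch`, crux `SblfDescent.RungOne`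

(Crux item stmt-SmoothPoincare4-18531; skeleton `Cruxes/RungOne/Lines/Sketch.lean`.)

Let `f : X → S²` be a genus-one Lefschetz-free simplified broken Lefschetz fibration of a closed
4-manifold whose round image is the equator, `v = (0, 0, ±1)` the torus-side pole,
`ι : S² × ℝ² ≅ f⁻¹{⟪·, v⟫ < 0}` the product structure of the sphere side
(`f (ι (x, w)) = ψ_v w`, `ψ_v = σ_v⁻¹ ∘ univBall 0 2`), and `ℓ(y) = y₀ (1 - ¼⟪y, v⟫)` the base
function, with exactly two critical points `m`, `M` (nondegenerate, indices `0`, `2`, both on the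
sphere side, `ℓ m < -1`, `1 < ℓ M`), and suppose the round points `q` of `f` are critical for
`ℓ ∘ f` iff `(f q)₁ = 0`, nondegenerate of index `3` over `(1, 0, 0)` and `1` over `(-1, 0, 0)`.
We PROVE (`stub_sixCrit`) that for the height `μ = ⟪e₂, ·⟫` on the fibre sphere, the ball
coordinates `w_m`, `w_M` of `m`, `M`, `r = dist(w_m, w_M)/3`, a plateau cutoff `ρ` and a small
`ε > 0`, the function `G = ℓ ∘ f + ε ρ(w) μ(x)` (product coordinates; `= ℓ ∘ f` off the sphere
side) is a Morse function with EXACTLY six critical points `ι (∓e₂, w_m)`, `q∓`, `ι (∓e₂, w_M)`,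
of indices `0, 2, 1, 3, 2, 4`, and `G(ι(-e₂,w_m)) < G(ι(e₂,w_m)) < -1 = G q₋ < G q₊ = 1 <
G(ι(-e₂,w_M)) < G(ι(e₂,w_M))` (Milnor 1963, §2–§3: block-sum Hessians `D²λ ⊕ ε D²μ` in the
product chart, no critical points in the cutoff annuli for `ε` small, germ of `ℓ ∘ f` off the
sphere side).  The generic pieces are the registered helpers of
`Theorems/SblfDescentRungOneStubSixCritAux1.lean` (product-chart Morse data, smoothness of the
perturbation) and `…Aux2.lean` (hemisphere chart, `ε` for the annuli, cutoff, round points).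

References: J. Milnor, *Morse theory* (1963), §2–§3 [Milnor1963]; T. Bröcker, K. Jänich,
*Introduction to Differential Topology* (1982), (8.12) [BrockerJanichIDT1982].
-/

set_option linter.dupNamespace false

noncomputable section

open scoped Manifold ContDiff Topology RealInnerProductSpace
open Set Function Literature.Topology.FourManifolds Literature.AlgebraicTopology.SingularHomology

namespace Summit.SmoothPoincare4.SmoothPoincare4.Cruxes.RungOne.Sketch

/-- Local notation: `𝔼 n` is the model Euclidean space `EuclideanSpace ℝ (Fin n)`. -/
local notation "𝔼 " n:arg => EuclideanSpace ℝ (Fin n)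

/-- Local notation: `𝕊²`, the unit sphere of `ℝ³`. -/
local notation "𝕊²" => (Metric.sphere (0 : EuclideanSpace ℝ (Fin 3)) (1 : ℝ))

attribute [local instance] Literature.Topology.FourManifolds.fact_finrank_euclideanSpace_succ

/-- **The six-point Morse function** (registered stub `stub_sixCrit` of line `Sketch`).  Data: a
genus-one Lefschetz-free SBLF `f` on a closed `X` with equatorial round image; the torus-side
pole `v`; the product structure `ι : S² × ℝ² ≅` (sphere side) with `f (ι (x, w)) = σ_v⁻¹
(univBall w)`; the base function `ℓ(y) = y₀ (1 - ¼⟪y, v⟫)` with its two nondegenerate critical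
points `m`, `M` (indices `0`, `2`) on the sphere side; the round critical points of `ℓ ∘ f`.
Conclusion: with `μ = ⟪e₂, ·⟫` the height on the fibre sphere (critical points `∓e₂` of
indices `0`, `2`), the ball coordinates `w_m`, `w_M` of `m`, `M`, `r = dist(w_m, w_M)/3`, a
plateau cutoff `ρ` and `ε > 0` small, `G = ℓ ∘ f + ε ρ(w) μ(x)` (in the product coordinates,
extended by `ℓ ∘ f`) is a Morse function on `X` with exactly six critical points
`ι (x∓, w_m)`, `q∓`, `ι (x∓, w_M)` of indices `0, 2, 1, 3, 2, 4` and values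
`ℓ m ∓ ε < -1 = G q₋ < G q₊ = 1 < ℓ M ∓ ε`.  Proof (Milnor 1963, §2–§3): in the product chart
the Hessian at `ι (x±, w∓)` is the block sum `D²λ ⊕ ε D²μ` (`λ = ℓ ∘ ψ_v`), there are no
critical points in the cutoff annuli for `ε` small (`Dλ ≠ 0` there) nor off the plateaus
(`Dλ = 0` only at `w_m`, `w_M`); off the sphere side `G` has the germ of `ℓ ∘ f`, regular at
regular points of `f` and with the prescribed Morse data at the two round points over
`(∓1, 0, 0)`. [cite: Milnor1963, §2, §3] [cite: BrockerJanichIDT1982, (8.12)] -/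
theorem stub_sixCrit :
    ∀ (X : Type) [TopologicalSpace X] [T2Space X] [SecondCountableTopology X] [CompactSpace X]
      [ChartedSpace (𝔼 4) X] [IsManifold (𝓡 4) ∞ X]
      (o : SmoothOrientation (𝓡 4) X) (f : X → 𝕊²),
      IsSimplifiedBrokenLefschetzFibration o f ∅ 0 →
      f '' ({p : X | ¬ Surjective (mfderiv (𝓡 4) (𝓡 2) f p)} \ (↑(∅ : Finset X) : Set X)) =
        sphereEquator 1 →
      ∀ (v : 𝕊²), (v : 𝔼 3) 0 = 0 → (v : 𝔼 3) 1 = 0 →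
      (∀ y : 𝕊², ⟪(y : 𝔼 3), (v : 𝔼 3)⟫ < 0 →
        (∀ q, f q = y → Surjective (mfderiv (𝓡 4) (𝓡 2) f q)) ∧
        Nonempty ((Fin (2 * 0) → ℤ) ≃ₗ[ℤ] singularHomology ℤ ℤ ↥(f ⁻¹' {y}) 1)) →
      (∀ y : 𝕊², ⟪(y : 𝔼 3), ((-v : 𝕊²) : 𝔼 3)⟫ < 0 →
        (∀ q, f q = y → Surjective (mfderiv (𝓡 4) (𝓡 2) f q)) ∧
        Nonempty ((Fin (2 * (0 + 1)) → ℤ) ≃ₗ[ℤ] singularHomology ℤ ℤ ↥(f ⁻¹' {y}) 1)) →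
      ∀ ℓ : 𝕊² → ℝ, ℓ = (fun y : 𝕊² => (y : 𝔼 3) 0 * (1 + (-(1 / 4 : ℝ)) * ⟪(y : 𝔼 3), (v : 𝔼 3)⟫)) →
      ∀ (ι : 𝕊² × 𝔼 2 → X),
      Manifold.IsSmoothEmbedding ((𝓡 2).prod (𝓡 2)) (𝓡 4) ∞ ι →
      range ι = f ⁻¹' {y : 𝕊² | ⟪(y : 𝔼 3), (v : 𝔼 3)⟫ < 0} →
      (∀ p, f (ι p) = (stereographic' 2 v).symm
        (OpenPartialHomeomorph.univBall (0 : 𝔼 2) 2 p.2)) →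
      ∀ (m M : 𝕊²), m ≠ M → (∀ y : 𝕊², IsMCriticalPt (𝓡 2) ℓ y ↔ (y = m ∨ y = M)) →
      (mhessian (𝓡 2) ℓ m).Nondegenerate → (mhessian (𝓡 2) ℓ M).Nondegenerate →
      morseIndex (𝓡 2) ℓ m = 0 → morseIndex (𝓡 2) ℓ M = 2 →
      ⟪(m : 𝔼 3), (v : 𝔼 3)⟫ < 0 → ⟪(M : 𝔼 3), (v : 𝔼 3)⟫ < 0 → ℓ m < -1 → 1 < ℓ M →
      (∀ q : X, ¬ Surjective (mfderiv (𝓡 4) (𝓡 2) f q) →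
        (IsMCriticalPt (𝓡 4) (ℓ ∘ f) q ↔ ((f q : 𝕊²) : 𝔼 3) 1 = 0) ∧
        (((f q : 𝕊²) : 𝔼 3) 1 = 0 → (mhessian (𝓡 4) (ℓ ∘ f) q).Nondegenerate ∧
          morseIndex (𝓡 4) (ℓ ∘ f) q = if 0 < ((f q : 𝕊²) : 𝔼 3) 0 then 3 else 1)) →
      ∃ (μ : 𝕊² → ℝ) (xm xM : 𝕊²) (wm wM : 𝔼 2) (r ε : ℝ) (ρ : 𝔼 2 → ℝ) (G : X → ℝ)
        (qm qM : X),
        ContMDiff (𝓡 2) 𝓘(ℝ, ℝ) ∞ μ ∧ xm ≠ xM ∧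
        (∀ x : 𝕊², IsMCriticalPt (𝓡 2) μ x ↔ (x = xm ∨ x = xM)) ∧
        (mhessian (𝓡 2) μ xm).Nondegenerate ∧ (mhessian (𝓡 2) μ xM).Nondegenerate ∧
        morseIndex (𝓡 2) μ xm = 0 ∧ morseIndex (𝓡 2) μ xM = 2 ∧ μ xm < μ xM ∧
        (stereographic' 2 v).symm (OpenPartialHomeomorph.univBall (0 : 𝔼 2) 2 wm) = m ∧
        (stereographic' 2 v).symm (OpenPartialHomeomorph.univBall (0 : 𝔼 2) 2 wM) = M ∧ 0 < r ∧
        2 * r < dist wm wM ∧ 0 < ε ∧ ContDiff ℝ ∞ ρ ∧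
        (∀ w, dist w wm ≤ r / 2 ∨ dist w wM ≤ r / 2 → ρ w = 1) ∧
        (∀ w, r ≤ dist w wm → r ≤ dist w wM → ρ w = 0) ∧ ContMDiff (𝓡 4) 𝓘(ℝ, ℝ) ∞ G ∧
        (∀ x : X, x ∉ range ι → G x = ℓ (f x)) ∧
        (∀ p : 𝕊² × 𝔼 2, G (ι p) = ℓ (f (ι p)) + ε * ρ p.2 * μ p.1) ∧
        ¬ Surjective (mfderiv (𝓡 4) (𝓡 2) f qm) ∧ ¬ Surjective (mfderiv (𝓡 4) (𝓡 2) f qM) ∧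
        ((f qm : 𝕊²) : 𝔼 3) 0 = -1 ∧ ((f qM : 𝕊²) : 𝔼 3) 0 = 1 ∧ IsMorse (𝓡 4) G ∧
        criticalSet (𝓡 4) G = {ι (xm, wm), ι (xM, wm), qm, qM, ι (xm, wM), ι (xM, wM)} ∧
        morseIndex (𝓡 4) G (ι (xm, wm)) = 0 ∧ morseIndex (𝓡 4) G (ι (xM, wm)) = 2 ∧
        morseIndex (𝓡 4) G qm = 1 ∧ morseIndex (𝓡 4) G qM = 3 ∧
        morseIndex (𝓡 4) G (ι (xm, wM)) = 2 ∧ morseIndex (𝓡 4) G (ι (xM, wM)) = 4 ∧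
        G (ι (xm, wm)) < G (ι (xM, wm)) ∧ G (ι (xM, wm)) < -1 ∧ G qm = -1 ∧ G qM = 1 ∧
        1 < G (ι (xm, wM)) ∧ G (ι (xm, wM)) < G (ι (xM, wM)) := by
  intro X _ _ _ _ _ _ o f hf hC v hv0 hv1 hlo hhi ℓ hℓ ι hemb hrange hιf m M hmM hcrit hndm hndM
    him hiM hmv hMv hmval hMval hround
  have _ := hlo; have _ := hhi
  /- ## the fibre Morse function `μ = ⟪e₂, ·⟫` on `S²` -/
  set a : 𝔼 3 := EuclideanSpace.single (2 : Fin 3) (1 : ℝ) with ha_def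
  have ha1 : ‖a‖ = 1 := by rw [ha_def, EuclideanSpace.norm_eq]; simp
  have ha : a ≠ 0 := norm_ne_zero_iff.1 (by rw [ha1]; exact one_ne_zero)
  set μ : 𝕊² → ℝ := SphereHeight.height a with hμ_def
  set xm : 𝕊² := SphereHeight.bot ha with hxm_def
  set xM : 𝕊² := SphereHeight.top ha with hxM_def
  have hμs : ContMDiff (𝓡 2) 𝓘(ℝ, ℝ) ∞ μ := SphereHeight.contMDiff_height a
  have hμM : IsMorse (𝓡 2) μ := SphereHeight.isMorse_height ha
  have hμcrit : ∀ x, IsMCriticalPt (𝓡 2) μ x ↔ (x = xm ∨ x = xM) := fun x => by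
    rw [← mem_criticalSet (I := 𝓡 2), hμ_def, SphereHeight.criticalSet_height ha]
    simp only [mem_insert_iff, mem_singleton_iff, hxm_def, hxM_def]
    exact Or.comm
  have hxmM : xm ≠ xM := (SphereHeight.top_ne_bot ha).symm
  have hixm : morseIndex (𝓡 2) μ xm = 0 := (SphereHeight.morseIndex_top_eq ha).2
  have hixM : morseIndex (𝓡 2) μ xM = 2 := (SphereHeight.morseIndex_top_eq ha).1
  have hμxm : μ xm = -1 := by rw [hμ_def, hxm_def, SphereHeight.height_bot, ha1]
  have hμxM : μ xM = 1 := by rw [hμ_def, hxM_def, SphereHeight.height_top, ha1]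
  have hμle : ∀ x : 𝕊², |μ x| ≤ 1 := fun x => by
    have h := abs_real_inner_le_norm a (x : 𝔼 3)
    rwa [norm_eq_of_mem_sphere x, ha1, mul_one] at h
  /- ## the hemisphere chart: `ψ`, `κ`, the ball coordinates `wm`, `wM`, and `λ = ℓ ∘ ψ` -/
  set ψ : 𝔼 2 → 𝕊² := fun w => (stereographic' 2 v).symm
    (OpenPartialHomeomorph.univBall (0 : 𝔼 2) 2 w) with hψ
  set κ : 𝕊² → 𝔼 2 := fun y => (OpenPartialHomeomorph.univBall (0 : 𝔼 2) 2).symm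
    (stereographic' 2 v y) with hκ
  have hκψ : ∀ w, κ (ψ w) = w := fun w =>
    univBall_symm_stereographic'_stereographic'_symm_univBall v w
  have hψκ : ∀ y : 𝕊², ⟪(y : 𝔼 3), (v : 𝔼 3)⟫ < 0 → ψ (κ y) = y := fun y hy =>
    stereographic'_symm_univBall_univBall_symm_stereographic' hy
  set wm : 𝔼 2 := κ m with hwm
  set wM : 𝔼 2 := κ M with hwM
  have hψwm : ψ wm = m := hψκ m hmv
  have hψwM : ψ wM = M := hψκ M hMv
  have hwmM : wm ≠ wM := fun h => hmM (by rw [← hψwm, ← hψwM, h])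
  have hℓs : ContMDiff (𝓡 2) 𝓘(ℝ, ℝ) ∞ ℓ := hℓ ▸ contMDiff_baseFn v
  have hψs : ContMDiff 𝓘(ℝ, 𝔼 2) (𝓡 2) ∞ ψ := contMDiff_stereographic'_symm_univBall v
  set lam : 𝔼 2 → ℝ := ℓ ∘ ψ with hlam
  have hlams : ContDiff ℝ ∞ lam := contMDiff_iff_contDiff.1 (hℓs.comp hψs)
  have hB := helper_sixCrit_hemisphere v ℓ hℓs ψ rfl
  have hlamcrit : ∀ w, fderiv ℝ lam w = 0 ↔ (w = wm ∨ w = wM) := fun w => by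
    rw [← (hB w).1, hcrit (ψ w)]
    constructor
    · rintro (h | h)
      · left; rw [← hκψ w, h]
      · right; rw [← hκψ w, h]
    · rintro (rfl | rfl)
      · exact Or.inl hψwm
      · exact Or.inr hψwM
  have hlam_m : (mhessian (𝓡 2) lam wm).Nondegenerate ∧ morseIndex (𝓡 2) lam wm = 0 := by
    have h := (hB wm).2
    rw [hψwm] at h
    obtain ⟨h1, h2⟩ := h ((hcrit m).2 (Or.inl rfl))
    exact ⟨h1.1 hndm, h2.symm.trans him⟩
  have hlam_M : (mhessian (𝓡 2) lam wM).Nondegenerate ∧ morseIndex (𝓡 2) lam wM = 2 := by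
    have h := (hB wM).2
    rw [hψwM] at h
    obtain ⟨h1, h2⟩ := h ((hcrit M).2 (Or.inr rfl))
    exact ⟨h1.1 hndM, h2.symm.trans hiM⟩
  /- ## the radius, the plateau cutoff, and `ε` -/
  have hdist : 0 < dist wm wM := dist_pos.2 hwmM
  set r : ℝ := dist wm wM / 3 with hr
  have hr0 : 0 < r := by positivity
  have hrr : 2 * r < dist wm wM := by rw [hr]; linarith
  obtain ⟨ρ, hρs, hρ1, hρ0, -⟩ := helper_sixCrit_cutoff wm wM r hr0 hrr
  have hρ1ev : ∀ w, dist w wm < r / 2 ∨ dist w wM < r / 2 → ρ =ᶠ[𝓝 w] fun _ => (1 : ℝ) := by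
    intro w hw
    rcases hw with hw | hw
    · filter_upwards [Metric.isOpen_ball.mem_nhds (Metric.mem_ball.2 hw)] with z hz
        using hρ1 z (Or.inl (Metric.mem_ball.1 hz).le)
    · filter_upwards [Metric.isOpen_ball.mem_nhds (Metric.mem_ball.2 hw)] with z hz
        using hρ1 z (Or.inr (Metric.mem_ball.1 hz).le)
  have hρ0ev : ∀ w, r < dist w wm → r < dist w wM → ρ =ᶠ[𝓝 w] fun _ => (0 : ℝ) := by
    intro w h1 h2
    have hc : ∀ c : 𝔼 2, Continuous fun z : 𝔼 2 => dist z c := fun c =>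
      continuous_id.dist continuous_const
    have ho : IsOpen {z : 𝔼 2 | r < dist z wm ∧ r < dist z wM} :=
      (isOpen_lt continuous_const (hc wm)).inter (isOpen_lt continuous_const (hc wM))
    filter_upwards [ho.mem_nhds ⟨h1, h2⟩] with z hz using hρ0 z hz.1.le hz.2.le
  have hδ : 0 < min (-1 - ℓ m) (ℓ M - 1) := lt_min (by linarith) (by linarith)
  obtain ⟨ε, hε, hεδ, hann⟩ := helper_sixCrit_annulus lam ρ wm wM r _ hlams hρs hr0 hδ
    fun w hw => (hlamcrit w).1 hw
  have hε1 : ε < -1 - ℓ m := hεδ.trans_le (min_le_left _ _)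
  have hε2 : ε < ℓ M - 1 := hεδ.trans_le (min_le_right _ _)
  /- ## the function `G` -/
  have hopen : IsOpen (range ι) := by
    rw [hrange]; exact (isOpen_setOf_inner_lt_zero v).preimage hf.contMDiff.continuous
  set K : Set (𝔼 2) := Metric.closedBall wm r ∪ Metric.closedBall wM r with hK
  have hKc : IsCompact K := (isCompact_closedBall _ _).union (isCompact_closedBall _ _)
  set h : 𝕊² × 𝔼 2 → ℝ := fun p => ε * (ρ p.2 * μ p.1) with hh
  have hhs : ContMDiff ((𝓡 2).prod (𝓡 2)) 𝓘(ℝ, ℝ) ∞ h :=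
    contMDiff_const.mul ((hρs.contMDiff.comp contMDiff_snd).mul (hμs.comp contMDiff_fst))
  have hhK : ∀ p : 𝕊² × 𝔼 2, p.2 ∉ K → h p = 0 := fun p hp => by
    have h1 : r ≤ dist p.2 wm := le_of_not_gt fun h' =>
      hp (Or.inl (Metric.mem_closedBall.2 h'.le))
    have h2 : r ≤ dist p.2 wM := le_of_not_gt fun h' =>
      hp (Or.inr (Metric.mem_closedBall.2 h'.le))
    simp only [hh, hρ0 p.2 h1 h2, zero_mul, mul_zero]
  have hℓf : ContMDiff (𝓡 4) 𝓘(ℝ, ℝ) ∞ (ℓ ∘ f) := hℓs.comp hf.contMDiff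
  obtain ⟨hGs, hGι, hGout, hGgerm⟩ :=
    helper_sixCrit_extend X ι hemb hopen (ℓ ∘ f) h K hℓf hhs hKc hhK
  set G : X → ℝ := fun y => (ℓ ∘ f) y + extend ι h 0 y with hG
  have hGin : ∀ p : 𝕊² × 𝔼 2, G (ι p) = lam p.2 + ε * (ρ p.2 * μ p.1) := fun p => by
    show (ℓ ∘ f) (ι p) + extend ι h 0 (ι p) = _
    rw [hGι p]
    simp only [Function.comp_apply, hιf p, hlam, hh, hψ]
  have hGout' : ∀ x : X, x ∉ range ι → G x = ℓ (f x) := fun x hx => hGout x hx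
  /- ## the round points and the critical points off the sphere side -/
  have hcritv : ∀ y : 𝕊², IsMCriticalPt (𝓡 2) ℓ y → ⟪(y : 𝔼 3), (v : 𝔼 3)⟫ < 0 := fun y hy => by
    rcases (hcrit y).1 hy with rfl | rfl
    exacts [hmv, hMv]
  obtain ⟨qm, qM, hqne, hqm, hqM, hqm0, hqM0, hℓqm, hℓqM, hqmv, hqMv, hoff⟩ :=
    helper_sixCrit_offRange X o f hf hC v hv0 hv1 ℓ hℓ hcritv hround
  have hnot_range : ∀ x, x ∉ range ι ↔ ¬ ⟪((f x : 𝕊²) : 𝔼 3), (v : 𝔼 3)⟫ < 0 := fun x => by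
    rw [hrange]; rfl
  have hqm_r : qm ∉ range ι := (hnot_range qm).2 hqmv
  have hqM_r : qM ∉ range ι := (hnot_range qM).2 hqMv
  have hoffx : ∀ x, x ∉ range ι → (IsMCriticalPt (𝓡 4) G x ↔ (x = qm ∨ x = qM)) ∧
      (IsMCriticalPt (𝓡 4) G x → (mhessian (𝓡 4) G x).Nondegenerate ∧
        morseIndex (𝓡 4) G x = if 0 < ((f x : 𝕊²) : 𝔼 3) 0 then 3 else 1) := fun x hx =>
    hoff G x ((hnot_range x).1 hx) (hGgerm x fun h' => hx (image_subset_range _ _ h'))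
  /- ## the critical points on the sphere side, in the product chart -/
  have hP := helper_sixCrit_prodChart X ι hemb hopen G lam ρ μ ε hlams hρs hμs hGin
  have hin : ∀ (x : 𝕊²) (w : 𝔼 2),
      IsMCriticalPt (𝓡 4) G (ι (x, w)) ↔ ((w = wm ∨ w = wM) ∧ (x = xm ∨ x = xM)) := by
    intro x w
    rw [(hP x w).1]
    by_cases h1 : dist w wm < r / 2 ∨ dist w wM < r / 2
    · -- on a plateau: `ρ ≡ 1` near `w`
      have hev := hρ1ev w h1
      have hρw : ρ w = 1 := hev.self_of_nhds
      have hDρ : fderiv ℝ ρ w = 0 := by rw [hev.fderiv_eq]; exact fderiv_const_apply _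
      rw [hDρ, smul_zero, add_zero, hρw, mul_one, hlamcrit w, hμcrit x, or_iff_right hε.ne']
    · rw [not_or, not_lt, not_lt] at h1
      obtain ⟨h1m, h1M⟩ := h1
      have hwne : ¬ (w = wm ∨ w = wM) := by
        rintro (rfl | rfl)
        · rw [dist_self] at h1m; linarith
        · rw [dist_self] at h1M; linarith
      constructor
      · rintro ⟨hsum, -⟩
        exfalso
        by_cases h2 : dist w wm ≤ r ∨ dist w wM ≤ r
        · -- in a cutoff annulus
          exact hann w h1m h1M h2 (μ x) (hμle x) hsum
        · -- off the cutoff balls: `ρ ≡ 0` near `w`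
          rw [not_or, not_le, not_le] at h2
          have hev := hρ0ev w h2.1 h2.2
          have hDρ : fderiv ℝ ρ w = 0 := by rw [hev.fderiv_eq]; exact fderiv_const_apply _
          rw [hDρ, smul_zero, add_zero] at hsum
          exact hwne ((hlamcrit w).1 hsum)
      · rintro ⟨hw, -⟩
        exact absurd hw hwne
  have hfour : ∀ (x : 𝕊²) (w : 𝔼 2), (x = xm ∨ x = xM) → (w = wm ∨ w = wM) →
      (mhessian (𝓡 4) G (ι (x, w))).Nondegenerate ∧
        morseIndex (𝓡 4) G (ι (x, w)) = morseIndex (𝓡 2) lam w + morseIndex (𝓡 2) μ x := by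
    intro x w hx hw
    have hc : IsMCriticalPt (𝓡 4) G (ι (x, w)) := (hin x w).2 ⟨hw, hx⟩
    have hd0 : dist w wm < r / 2 ∨ dist w wM < r / 2 := by
      rcases hw with rfl | rfl
      · left; rw [dist_self]; positivity
      · right; rw [dist_self]; positivity
    have hndl : (mhessian (𝓡 2) lam w).Nondegenerate := by
      rcases hw with rfl | rfl
      exacts [hlam_m.1, hlam_M.1]
    exact (hP x w).2 (hρ1ev w hd0) hε hc hndl (hμM.nondegenerate ((hμcrit x).2 hx))
  /- ## the critical set -/
  have hinj : Injective ι := hemb.isEmbedding.injective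
  have hιeq : ∀ (x x' : 𝕊²) (w w' : 𝔼 2), ι (x, w) = ι (x', w') ↔ (x = x' ∧ w = w') :=
    fun x x' w w' => by rw [hinj.eq_iff, Prod.mk.injEq]
  have hιqm : ∀ p, ι p ≠ qm := fun p h' => hqm_r ⟨p, h'⟩
  have hιqM : ∀ p, ι p ≠ qM := fun p h' => hqM_r ⟨p, h'⟩
  have hcritSet : criticalSet (𝓡 4) G =
      {ι (xm, wm), ι (xM, wm), qm, qM, ι (xm, wM), ι (xM, wM)} := by
    ext x
    simp only [mem_criticalSet, mem_insert_iff, mem_singleton_iff]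
    by_cases hx : x ∈ range ι
    · obtain ⟨⟨x', w⟩, rfl⟩ := hx
      rw [hin x' w]
      simp only [hιeq, hιqm, hιqM, false_or]
      constructor
      · rintro ⟨hw | hw, hx' | hx'⟩ <;> simp [hw, hx']
      · rintro (⟨hx', hw⟩ | ⟨hx', hw⟩ | ⟨hx', hw⟩ | ⟨hx', hw⟩) <;> simp [hx', hw]
    · rw [(hoffx x hx).1]
      have hxι : ∀ p, x ≠ ι p := fun p h' => hx ⟨p, h'.symm⟩
      simp only [hxι, false_or, or_false]
  have hMorse : IsMorse (𝓡 4) G := by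
    refine ⟨hGs, fun x hx => ?_⟩
    by_cases hxr : x ∈ range ι
    · obtain ⟨⟨x', w⟩, rfl⟩ := hxr
      obtain ⟨hw, hx'⟩ := (hin x' w).1 hx
      exact (hfour x' w hx' hw).1
    · exact ((hoffx x hxr).2 hx).1
  /- ## indices and values -/
  have hiqm : morseIndex (𝓡 4) G qm = 1 := by
    rw [((hoffx qm hqm_r).2 ((hoffx qm hqm_r).1.2 (Or.inl rfl))).2, hqm0, if_neg (by norm_num)]
  have hiqM : morseIndex (𝓡 4) G qM = 3 := by
    rw [((hoffx qM hqM_r).2 ((hoffx qM hqM_r).1.2 (Or.inr rfl))).2, hqM0, if_pos one_pos]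
  have hval : ∀ (x : 𝕊²) (w : 𝔼 2), (w = wm ∨ w = wM) → G (ι (x, w)) = lam w + ε * μ x := by
    intro x w hw
    rw [hGin]
    have : ρ w = 1 := hρ1 w (by
      rcases hw with rfl | rfl
      · left; rw [dist_self]; positivity
      · right; rw [dist_self]; positivity)
    simp only [this, one_mul]
  have hlamwm : lam wm = ℓ m := by simp only [hlam, Function.comp_apply, hψwm]
  have hlamwM : lam wM = ℓ M := by simp only [hlam, Function.comp_apply, hψwM]
  have hGqm : G qm = -1 := (hGout' qm hqm_r).trans hℓqm
  have hGqM : G qM = 1 := (hGout' qM hqM_r).trans hℓqM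
  refine ⟨μ, xm, xM, wm, wM, r, ε, ρ, G, qm, qM, hμs, hxmM, hμcrit,
    hμM.nondegenerate ((hμcrit xm).2 (Or.inl rfl)), hμM.nondegenerate ((hμcrit xM).2 (Or.inr rfl)),
    hixm, hixM, by rw [hμxm, hμxM]; norm_num, hψwm, hψwM, hr0, hrr, hε, hρs, hρ1, hρ0, hGs,
    hGout', fun p => by rw [hGin, hιf]; simp only [hlam, hψ, Function.comp_apply]; ring,
    hqm, hqM, hqm0, hqM0, hMorse, hcritSet, ?_, ?_, hiqm, hiqM, ?_, ?_, ?_, ?_, hGqm, hGqM, ?_, ?_⟩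
  · rw [(hfour xm wm (Or.inl rfl) (Or.inl rfl)).2, hlam_m.2, hixm]
  · rw [(hfour xM wm (Or.inr rfl) (Or.inl rfl)).2, hlam_m.2, hixM]
  · rw [(hfour xm wM (Or.inl rfl) (Or.inr rfl)).2, hlam_M.2, hixm]
  · rw [(hfour xM wM (Or.inr rfl) (Or.inr rfl)).2, hlam_M.2, hixM]
  · rw [hval xm wm (Or.inl rfl), hval xM wm (Or.inl rfl), hμxm, hμxM]; linarith
  · rw [hval xM wm (Or.inl rfl), hlamwm, hμxM]; linarith
  · rw [hval xm wM (Or.inr rfl), hlamwM, hμxm]; linarith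
  · rw [hval xm wM (Or.inr rfl), hval xM wM (Or.inr rfl), hμxm, hμxM]; linarith

end Summit.SmoothPoincare4.SmoothPoincare4.Cruxes.RungOne.Sketch

end
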